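import Summits.Ventures.PercRepro.RankLevelSetLevelSevenRowSixtySix
import Summits.Ventures.PercRepro.RankLevelSetCoreSevenOfFormS345
import Summits.Ventures.PercRepro.S1TriangleCountSharperB
import Summits.Ventures.PercRepro.S1FiveCircuitCountSharpC
import Summits.Ventures.PercRepro.RankLevelSetLevelSevenRowSixtyFiveSSSForm
import Summits.Ventures.PercRepro.RankLevelSetLevelSevenRowSixtyFiveLarge

/-!
# PercRepro — THE ROW `65` OF LEVEL `7`: C-025 AT `q = 7` FOR EVERY FINITE MATROID AND EVERY `p ≥ 65` (p8, gen 19; a feeder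
for S4 — the top of the `q = 7` window, from `66`; the first row on THE SHARPER TRIANGLE COUNT AND THE SHARP FIVE-CIRCUIT COUNT)

Level `7` at rank `65` by the per-rank wrapper `rls_succ_large_at 6 7 65` (p8 g0, S3SixWindow): level `6` at `64`
(`c025_six_all`) and the `e`-free core at `(65, d)` for every `d ≥ 8` — the cells `8 ≤ d ≤ 94` by their numeric forms ON THE
GIANT-EXACT COUNT WITH THE SHARP TRIANGLE, FOUR- AND FIVE-CIRCUIT COUNTS (`quart_form65sss`,
RankLevelSetLevelSevenRowSixtyFiveSSSForm: the `N`-side `C(n, 7) + σ_m·Π_E‴ + 2^{min 79 (7+d)}` with `2·s₃ + 3d ≤ d² + 12`,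
`3·s₄ ≤ d³ + 11d` and `48·s₅ ≤ 7d(d+1)(d² + d + 10)` — the cells `(65, 30 … 33)` FAIL with the sharp triangle count and
LEMMA T5, `N`-side `1.003 … 1.036`, and close here at `≤ 0.994`) through `c025_core_seven_of_form_s345`
(RankLevelSetCoreSevenOfFormS345) with `hs3` from `S1.two_mul_ncard_triangles_add_le_sq_add_twelve`
(S1TriangleCountSharperB), `hs4` from `S1.three_mul_ncard_four_circuits_le_sharp` (S1FourCircuitCountSharpC) and `hs5` from
`S1.fortyEight_mul_ncard_five_circuits_le_sharp` (S1FiveCircuitCountSharpC), the coranks `d ≥ 95` by the large-corank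
inequality at `(65, n ≥ 160)` (`largeSeven_all65`) through `c025_core_seven_large_of_ineq` (RankLevelSetCoreSevenOfForm).
The rows `≥ 66` are `c025_seven_large_sixty_six`.
* **`c025_core_seven_at_sixty_five`** — the `e`-free core at rank `65`, every corank `d ≥ 8`;
* **`c025_seven_at_sixty_five`** — level `7` at rank `65`, every finite matroid;
* **`c025_seven_large_sixty_five`** — level `7` for every `p ≥ 65`; **`c025_seven_sixty_five`** the same in the `C025` body.
Axioms: standard.
-/

open scoped Matroid

namespace PercRepro

namespace ThmN

variable {α : Type}

/-- **The `e`-free core of level `7` at rank `65`, every corank `d ≥ 8`**: the numeric forms of the cells `(65, 8 … 94)` on the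
giant-exact count with the sharp triangle, four- and five-circuit counts, and the large-corank inequality at `(65, n ≥ 160)`. -/
theorem c025_core_seven_at_sixty_five (M : Matroid α) [M.Finite] (d : ℕ) (hd8 : 8 ≤ d) (hR : M.eRank = (65 : ℕ∞))
    (hn : M.E.ncard = 65 + d) (hfree : EFree M) : RLS M 65 7 := by
  rcases Nat.lt_or_ge d 95 with h | h
  · -- the circuit bounds: the sharper triangle count, the sharp four- and five-circuit counts
    have hd : M.E.encard = M.eRank + d := by
      rw [hR, ← M.ground_finite.cast_ncard_eq, hn]
      push_cast
      ring
    have hs : ∀ e ∈ M.E, ∀ f ∈ M.E, e ≠ f → M.eRk {e, f} = 2 := by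
      intro e he f hf hef
      have h2 : (2 : ℕ∞) ≤ M.eRk {e, f} :=
        two_le_eRk_of_two_le_ncard_of_free M hfree (Set.pair_subset he hf) (by rw [Set.ncard_pair hef])
      have h3 : M.eRk {e, f} ≤ 2 := by
        have := M.eRk_le_encard {e, f}
        rwa [Set.encard_pair hef] at this
      exact le_antisymm h3 h2
    have hC1 : ∀ L ⊆ M.E, M.eRk L = 2 → L.ncard ≤ 3 :=
      fun L hL hr => ncard_le_three_of_eRk_two M hs hfree hL hr
    have hC2 : ∀ P ⊆ M.E, M.eRk P ≤ 3 → P.ncard ≤ 6 :=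
      fun P hP hr => ncard_le_six_of_eRk_le_three_of_free M hfree hP hr
    have hC3 : ∀ X ⊆ M.E, M.eRk X ≤ 4 → X.ncard ≤ 10 :=
      fun X hX hr => ncard_le_ten_of_eRk_le_four_of_free M hfree hX hr
    have hs3 : {C | M.IsCircuit C ∧ C.ncard = 3}.ncard ≤ (d * d - 3 * d + 12) / 2 := by
      have hT : 2 * {C | M.IsCircuit C ∧ C.ncard = 3}.ncard + 3 * d ≤ d * d + 12 :=
        S1.two_mul_ncard_triangles_add_le_sq_add_twelve M hC1 hd
      have h3d : 3 * d ≤ d * d := Nat.mul_le_mul_right d (by omega)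
      omega
    have hs4 : {C | M.IsCircuit C ∧ C.ncard = 4}.ncard ≤ (d * d * d + 11 * d) / 3 := by
      have hT4 : 3 * {C : Set α | M.IsCircuit C ∧ C.ncard = 4}.ncard ≤ d * d * d + 11 * d :=
        S1.three_mul_ncard_four_circuits_le_sharp M hC2 hd
      omega
    have hs5 : {C | M.IsCircuit C ∧ C.ncard = 5}.ncard ≤ 7 * d * (d + 1) * (d * d + d + 10) / 48 := by
      have hT5 : 48 * {C : Set α | M.IsCircuit C ∧ C.ncard = 5}.ncard ≤ 7 * d * (d + 1) * (d * d + d + 10) :=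
        S1.fortyEight_mul_ncard_five_circuits_le_sharp M hC3 hd
      rw [Nat.le_div_iff_mul_le (by norm_num)]
      linarith [hT5]
    exact c025_core_seven_of_form_s345 M 65 d ((d * d - 3 * d + 12) / 2) ((d * d * d + 11 * d) / 3)
      (7 * d * (d + 1) * (d * d + d + 10) / 48) hd8 hR hn hfree hs3 hs4 hs5 (quart_form65sss d hd8 (by omega))
  · exact c025_core_seven_large_of_ineq M 65 hR (largeSeven_all65 M.E.ncard (by omega)) hfree

/-- **Level `7` at rank `65`, every finite matroid**: `rls_succ_large_at 6 7 65` on level `6` at `64` (`c025_six_all`), the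
coranks `≤ 7` (`U = ∅` or Theorem M) and the core at `65`. -/
theorem c025_seven_at_sixty_five (M : Matroid α) [M.Finite] : RLS M 65 7 := by
  refine rls_succ_large_at (α := α) 6 7 65 (by norm_num) (fun M _ => c025_six_all M 64 (by norm_num)) ?_ ?_ M
  · -- corank `≤ 7`: `U = ∅` or Theorem M
    intro M _ hn
    rcases Nat.lt_or_ge M.E.ncard (65 + 7) with h | h
    · exact RLS_of_ncard_lt M h
    · exact RLS_of_ncard_eq M (by omega)
  · -- the core at corank `≥ 8`
    intro M _ hR hbig hfree
    exact c025_core_seven_at_sixty_five M (M.E.ncard - 65) (by omega) hR (by omega) hfree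

/-- **THEOREM C₇ AT `65`, UNCONDITIONAL OVER THE TREE**: every finite matroid satisfies C-025 at level `7` for every
`p ≥ 65` — the row `65` by `c025_seven_at_sixty_five`, the rows `≥ 66` by `c025_seven_large_sixty_six`. -/
theorem c025_seven_large_sixty_five (M : Matroid α) [M.Finite] (p : ℕ) (hp : 65 ≤ p) : RLS M p 7 := by
  rcases Nat.lt_or_ge p 66 with h | h
  · have h65 : p = 65 := by omega
    subst h65
    exact c025_seven_at_sixty_five M
  · exact c025_seven_large_sixty_six M p h

/-- The same in the literal `C025` body: `phiK p 7 · #U(p, 7) ≤ #Y(p, 7)` for every finite matroid and every `p ≥ 65`. -/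
theorem c025_seven_sixty_five (M : Matroid α) [M.Finite] (p : ℕ) (hp : 65 ≤ p) :
    phiK p 7 * ({A : Set α | A ⊆ M.E ∧ M.eRk A = (p : ℕ∞) ∧ M.eRk (M.E \ A) = (7 : ℕ∞)}.ncard : ℚ) ≤
      ({A : Set α | A ⊆ M.E ∧ (7 : ℕ∞) < M.eRk A ∧ M.eRk A < (p : ℕ∞)}.ncard : ℚ) :=
  c025_seven_large_sixty_five M p hp

end ThmN

end PercRepro
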